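import Summits.KontsevichZagierPeriods.KontsevichZagierPeriods.Theses.FurushoPentagon
import Summits.KontsevichZagierPeriods.KontsevichZagierPeriods.Theorems.FurushoPentagonReducedPeriodRingDefs
import Literature.NumberTheory.Transcendental.KZCubicalCalculus
import Literature.NumberTheory.Transcendental.KZLogCalculusProofs
import Literature.NumberTheory.Transcendental.KZMellinFibres
import Literature.NumberTheory.Transcendental.KZSemiCanonicalReductionProofs
import Literature.NumberTheory.Transcendental.KZProductIdeal
import Literature.NumberTheory.Transcendental.SemialgebraicMapsProofs

/-!
# `SectorToKernel`, line `effective-cube-surjection`: Beukers' box representation of `ζ(2)` is resolved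

Stub Z1 `stub_zetaTwoBoxResolved` (wave 3) of the crux `FurushoPentagon.SectorToKernel`
(stmt-KontsevichZagierPeriods-10813). Beukers' representation `ζ(2) = ∫∫_{(0,1)²} dx dy / (1 − xy)`
has an integrand which is singular at the corner `(1,1)`; we show that its class is, modulo the
Kontsevich–Zagier relations, twice a *tame cube class* (domain `[0,1]²`, integrand analytic on a
neighbourhood of the closed square), by an explicit chain of KZ moves:

1. the two reflections `x ↦ 1 − x`, `y ↦ 1 − y` (rule (2), `KZ.of_sub_of_mem_relations_of_boxReflection`)
   turn the integrand into `1/(x + y − xy)`, singular at the origin only;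
2. the square is cut along the diagonal (rule (1), `KZ.of_sub_sum_of_mem_relations`) into the
   triangle `T = {0 < x < 1, 0 ≤ y ≤ x}` and its mirror image, which is `T` reindexed by the
   coordinate swap (rule (2), `KZ.of_sub_of_reindex_mem_relations`; the integrand is symmetric);
3. on `T` the corner blow-up `y = x θ` (rule (2), the affine fibrewise substitution
   `KZ.of_sub_of_mem_relations_of_affine`, Jacobian `x`) gives the integrand
   `x/(x + xθ − x²θ) = 1/(1 + θ(1 − x))`, analytic near `[0,1]²` (denominator `≥ 1`);
4. up to two null edges (rule (1)) this is the tame cube class `[[0,1]², 1/(1 + θ(1 − x))]`.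

References: F. Beukers, *A note on the irrationality of ζ(2) and ζ(3)*, Bull. LMS 11 (1979);
M. Kontsevich, D. Zagier, *Periods* (2001), §1.1–1.2; J. Ayoub, *Periods and the conjectures of
Grothendieck and Kontsevich–Zagier*, EMS Newsl. 91 (2014), Def. 6.
-/

noncomputable section

namespace Summit.KontsevichZagierPeriods.FurushoPentagon.SectorToKernel

open Set MeasureTheory
open Literature.NumberTheory.Transcendental
open Literature.NumberTheory.Transcendental.KZ hiding cubicalSpan
open Summit.KontsevichZagierPeriods.KontsevichZagierPeriods.Theses.FurushoPentagon
open Summit.KontsevichZagierPeriods.FurushoPentagon.ReducedPeriodRing (unitCube cubicalGens cubicalSpan)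
open Literature.ModelTheory.ExponentialFields (IsSemialgebraic isSemialgebraic_univ)

/-- Membership in the closed-fibre triangle `T = {0 < x₀ < 1, 0 ≤ x₁ ≤ x₀}`, written as a band over
the open unit interval of `ℝ¹`. [folklore] -/
theorem z2_mem_tri {z : Fin 2 → ℝ} :
    z ∈ KZlog.band {y : Fin 1 → ℝ | 0 < y 0 ∧ y 0 < 1} (fun _ => (0:ℝ)) (fun y => y 0) ↔
      (0 < z 0 ∧ z 0 < 1) ∧ 0 ≤ z 1 ∧ z 1 ≤ z 0 := Iff.rfl

/-- Membership in the box band `{0 < x₀ < 1, 0 ≤ x₁ ≤ 1}`. [folklore] -/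
theorem z2_mem_boxBand {z : Fin 2 → ℝ} :
    z ∈ KZlog.band {y : Fin 1 → ℝ | 0 < y 0 ∧ y 0 < 1} (fun _ => (0:ℝ)) (fun _ => (1:ℝ)) ↔
      (0 < z 0 ∧ z 0 < 1) ∧ 0 ≤ z 1 ∧ z 1 ≤ 1 := Iff.rfl

/-- The blow-up identity `x · 1/(x + xθ − x·xθ) = 1/(1 + θ(1 − x))` for `x ≠ 0`. [folklore] -/
theorem z2_blowup_identity {x t : ℝ} (hx : x ≠ 0) :
    1 / (1 + t * (1 - x)) = 1 / (x + (0 + x * t) - x * (0 + x * t)) * x := by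
  have hD : x + (0 + x * t) - x * (0 + x * t) = x * (1 + t * (1 - x)) := by ring
  rw [hD, div_mul_eq_mul_div, one_mul, div_mul_cancel_left₀ hx, one_div]

/-- Absolute convergence on the open box is preserved by composing with a box reflection
(`x_j ↦ 1 − x_j` maps the box onto itself with Jacobian of absolute value `1`;
`MeasureTheory.integrableOn_image_iff_integrableOn_abs_det_fderiv_smul`).
[Kontsevich–Zagier 2001, §1.2 rule (2)] [folklore] -/
theorem z2_integrableOn_comp_boxReflection (j : Fin 2) {B : Set (Fin 2 → ℝ)}
    (hB : B = {x : Fin 2 → ℝ | ∀ i, x i ∈ Set.Ioo (0:ℝ) 1}) (hBm : MeasurableSet B)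
    {f : (Fin 2 → ℝ) → ℝ} (hf : IntegrableOn f B) :
    IntegrableOn (fun x => f (boxReflection j x)) B := by
  obtain ⟨L, hdet, hL⟩ := exists_hasFDerivAt_boxReflection j
  have hpre : boxReflection j ⁻¹' B = B := by
    ext x
    simp only [hB, mem_preimage, mem_setOf_eq, forall_boxReflection_mem_Ioo_iff]
  have himg : boxReflection j '' B = B :=
    calc boxReflection j '' B = boxReflection j '' (boxReflection j ⁻¹' B) := by rw [hpre]
      _ = B := image_preimage_eq _ (boxReflection_involutive j).surjective
  have key := integrableOn_image_iff_integrableOn_abs_det_fderiv_smul volume hBm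
    (f' := fun _ => L) (fun x _ => (hL x).hasFDerivWithinAt)
    (boxReflection_involutive j).injective.injOn f
  rw [himg] at key
  refine (key.1 hf).congr_fun (fun x _ => ?_) hBm
  simp only [hdet, one_smul]

/-- **One box reflection** `x_j ↦ 1 − x_j` of a representation on the open box `(0,1)²`, with a
prescribed `ℚ`-semialgebraic new integrand `φ` agreeing with `f ∘ (x_j ↦ 1 − x_j)` on the box: a
change-of-variables move (`KZ.of_sub_of_mem_relations_of_boxReflection`).
[Kontsevich–Zagier 2001, §1.2 rule (2)] -/
theorem z2_reflect (j : Fin 2) (Z : IntegralRep 2)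
    (hZ : Z.domain = {x : Fin 2 → ℝ | ∀ i, x i ∈ Set.Ioo (0:ℝ) 1})
    (φ : (Fin 2 → ℝ) → ℝ) (hφ : IsSemialgebraicFunOn ℚ Z.domain φ)
    (hφZ : ∀ x ∈ Z.domain, φ x = Z.integrand (boxReflection j x)) :
    ∃ Z' : IntegralRep 2, Z'.domain = Z.domain ∧ Z'.integrand = φ ∧ of Z' - of Z ∈ relations := by
  have hBm : MeasurableSet Z.domain := IntegralRep.measurableSet_domain_holds Z
  have hint : IntegrableOn φ Z.domain :=
    (z2_integrableOn_comp_boxReflection j hZ hBm Z.integrableOn).congr_fun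
      (fun x hx => (hφZ x hx).symm) hBm
  have hpre : Z.domain = boxReflection j ⁻¹' Z.domain := by
    ext x
    simp only [hZ, mem_preimage, mem_setOf_eq, forall_boxReflection_mem_Ioo_iff]
  exact ⟨⟨Z.domain, φ, Z.isSemialgebraic_domain, hφ, hint⟩, rfl, rfl,
    of_sub_of_mem_relations_of_boxReflection j hpre hφZ⟩

/-- **The two reflections.** After `x ↦ (1 − x₀, 1 − x₁)` (two box reflections, rule (2)) Beukers'
representation `[(0,1)², 1/(1 − x₀x₁)]` becomes `[(0,1)², 1/(x₀ + x₁ − x₀x₁)]`, whose integrand is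
singular at the origin only. [Kontsevich–Zagier 2001, §1.2 rule (2)] -/
theorem z2_exists_reflected (Z : IntegralRep 2)
    (hZ : Z.domain = {x : Fin 2 → ℝ | ∀ i, x i ∈ Set.Ioo (0:ℝ) 1})
    (hZi : ∀ x ∈ Z.domain, Z.integrand x = 1 / (1 - x 0 * x 1)) :
    ∃ Za : IntegralRep 2, Za.domain = {x : Fin 2 → ℝ | ∀ i, x i ∈ Set.Ioo (0:ℝ) 1} ∧
      (Za.integrand = fun x => 1 / (x 0 + x 1 - x 0 * x 1)) ∧ of Za - of Z ∈ relations := by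
  have hmem : ∀ x ∈ Z.domain, (0 < x 0 ∧ x 0 < 1) ∧ (0 < x 1 ∧ x 1 < 1) := fun x hx => by
    rw [hZ] at hx
    exact ⟨hx 0, hx 1⟩
  -- first reflection `x₀ ↦ 1 − x₀`
  have hsa₁ : IsSemialgebraicFunOn ℚ Z.domain (fun x => 1 / (1 - (1 - x 0) * x 1)) := by
    refine (isSemialgebraicFunOn_aeval_div_aeval Z.isSemialgebraic_domain 1
      (1 - (1 - MvPolynomial.X 0) * MvPolynomial.X 1) fun x hx => ?_).congr fun x _ => by simp
    have h := hmem x hx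
    simp only [map_sub, map_mul, map_one, MvPolynomial.aeval_X]
    exact (show (0:ℝ) < 1 - (1 - x 0) * x 1 by nlinarith [h.1.1, h.1.2, h.2.1, h.2.2]).ne'
  have hφ₁ : ∀ x ∈ Z.domain, (fun x : Fin 2 → ℝ => 1 / (1 - (1 - x 0) * x 1)) x =
      Z.integrand (boxReflection 0 x) := by
    intro x hx
    have hx' : boxReflection 0 x ∈ Z.domain := by
      rw [hZ] at hx ⊢
      exact forall_boxReflection_mem_Ioo_iff.2 hx
    rw [hZi _ hx', boxReflection_apply_self,
      boxReflection_apply_of_ne (show (1 : Fin 2) ≠ 0 by decide)]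
  obtain ⟨Zb, hZbd, hZbi, e1⟩ := z2_reflect 0 Z hZ _ hsa₁ hφ₁
  -- second reflection `x₁ ↦ 1 − x₁`
  have hmem' : ∀ x ∈ Zb.domain, (0 < x 0 ∧ x 0 < 1) ∧ (0 < x 1 ∧ x 1 < 1) := by
    rw [hZbd]
    exact hmem
  have hsa₂ : IsSemialgebraicFunOn ℚ Zb.domain (fun x => 1 / (x 0 + x 1 - x 0 * x 1)) := by
    refine (isSemialgebraicFunOn_aeval_div_aeval Zb.isSemialgebraic_domain 1
      (MvPolynomial.X 0 + MvPolynomial.X 1 - MvPolynomial.X 0 * MvPolynomial.X 1)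
      fun x hx => ?_).congr fun x _ => by simp
    have h := hmem' x hx
    simp only [map_sub, map_mul, map_add, MvPolynomial.aeval_X]
    exact (show (0:ℝ) < x 0 + x 1 - x 0 * x 1 by nlinarith [h.1.1, h.1.2, h.2.1, h.2.2]).ne'
  have hφ₂ : ∀ x ∈ Zb.domain, (fun x : Fin 2 → ℝ => 1 / (x 0 + x 1 - x 0 * x 1)) x =
      Zb.integrand (boxReflection 1 x) := by
    intro x _
    rw [hZbi]
    simp only [boxReflection_apply_self,
      boxReflection_apply_of_ne (show (0 : Fin 2) ≠ 1 by decide)]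
    congr 1
    ring
  obtain ⟨Za, hZad, hZai, e2⟩ := z2_reflect 1 Zb (hZbd.trans hZ) _ hsa₂ hφ₂
  refine ⟨Za, hZad.trans (hZbd.trans hZ), hZai, ?_⟩
  have : of Za - of Z = (of Za - of Zb) + (of Zb - of Z) := by abel
  rw [this]
  exact relations.add_mem e2 e1

/-- **The reflected integrand on the closed-fibre triangle** `T = {0 < x₀ < 1, 0 ≤ x₁ ≤ x₀}` is an
integral representation: `x₀ + x₁ − x₀x₁ ≥ x₀ > 0` on `T`, and absolute convergence is inherited from
the open box (the edge `x₁ = 0` is null). [Kontsevich–Zagier 2001, §1.1] -/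
theorem z2_exists_triRep (Za : IntegralRep 2)
    (hd : Za.domain = {x : Fin 2 → ℝ | ∀ i, x i ∈ Set.Ioo (0:ℝ) 1})
    (hi : Za.integrand = fun x => 1 / (x 0 + x 1 - x 0 * x 1)) :
    ∃ R : IntegralRep 2,
      R.domain = KZlog.band {y : Fin 1 → ℝ | 0 < y 0 ∧ y 0 < 1} (fun _ => (0:ℝ)) (fun y => y 0) ∧
      R.integrand = fun x => 1 / (x 0 + x 1 - x 0 * x 1) := by
  have hG : IsSemialgebraic ℚ {y : Fin 1 → ℝ | 0 < y 0 ∧ y 0 < 1} :=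
    isSemialgebraic_unitInterval_fin_one
  have hT : IsSemialgebraic ℚ
      (KZlog.band {y : Fin 1 → ℝ | 0 < y 0 ∧ y 0 < 1} (fun _ => (0:ℝ)) (fun y => y 0)) :=
    KZlog.isSemialgebraic_band (by simpa using isSemialgebraicFunOn_ratCast hG 0)
      (isSemialgebraicFunOn_apply hG 0)
  have hsa : IsSemialgebraicFunOn ℚ
      (KZlog.band {y : Fin 1 → ℝ | 0 < y 0 ∧ y 0 < 1} (fun _ => (0:ℝ)) (fun y => y 0))
      (fun x => 1 / (x 0 + x 1 - x 0 * x 1)) := by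
    refine (isSemialgebraicFunOn_aeval_div_aeval hT 1
      (MvPolynomial.X 0 + MvPolynomial.X 1 - MvPolynomial.X 0 * MvPolynomial.X 1)
      fun x hx => ?_).congr fun x _ => by simp
    have h := z2_mem_tri.1 hx
    simp only [map_sub, map_mul, map_add, MvPolynomial.aeval_X]
    exact (show (0:ℝ) < x 0 + x 1 - x 0 * x 1 by nlinarith [h.1.1, h.1.2, h.2.1, h.2.2]).ne'
  have hsub : KZlog.band {y : Fin 1 → ℝ | 0 < y 0 ∧ y 0 < 1} (fun _ => (0:ℝ)) (fun y => y 0) ⊆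
      Za.domain ∪ {z | z 1 = 0} := by
    intro z hz
    have h := z2_mem_tri.1 hz
    rcases h.2.1.eq_or_lt with h0 | h0
    · exact Or.inr h0.symm
    · refine Or.inl ?_
      rw [hd]
      show ∀ i, z i ∈ Set.Ioo (0:ℝ) 1
      exact Fin.forall_fin_two.2 ⟨⟨h.1.1, h.1.2⟩, ⟨h0, h.2.2.trans_lt h.1.2⟩⟩
  have hZa : IntegrableOn (fun x : Fin 2 → ℝ => 1 / (x 0 + x 1 - x 0 * x 1)) Za.domain := by
    rw [← hi]
    exact Za.integrableOn
  have hint : IntegrableOn (fun x : Fin 2 → ℝ => 1 / (x 0 + x 1 - x 0 * x 1))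
      (KZlog.band {y : Fin 1 → ℝ | 0 < y 0 ∧ y 0 < 1} (fun _ => (0:ℝ)) (fun y => y 0)) :=
    (hZa.union (IntegrableOn.of_measure_zero
      (Measure.pi_hyperplane (fun _ => (volume : Measure ℝ)) 1 0))).mono_set hsub
  exact ⟨⟨_, _, hT, hsa, hint⟩, rfl, rfl⟩

/-- **Cutting along the diagonal** (rule (1), `KZ.of_sub_sum_of_mem_relations`): up to the null
diagonal and two null edges, the open box is the almost-disjoint union of the triangle `T` below the
diagonal and of its mirror image, which is `T` reindexed by the coordinate swap; the reflected
integrand is symmetric. [Kontsevich–Zagier 2001, §1.2 rule (1)] -/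
theorem z2_split (Za R : IntegralRep 2)
    (hZad : Za.domain = {x : Fin 2 → ℝ | ∀ i, x i ∈ Set.Ioo (0:ℝ) 1})
    (hZai : Za.integrand = fun x => 1 / (x 0 + x 1 - x 0 * x 1))
    (hRd : R.domain = KZlog.band {y : Fin 1 → ℝ | 0 < y 0 ∧ y 0 < 1} (fun _ => (0:ℝ)) (fun y => y 0))
    (hRi : R.integrand = fun x => 1 / (x 0 + x 1 - x 0 * x 1)) :
    of Za - (of R + of (R.reindex (Equiv.swap (0 : Fin 2) 1))) ∈ relations := by
  have hmemR : ∀ z, z ∈ R.domain ↔ (0 < z 0 ∧ z 0 < 1) ∧ 0 ≤ z 1 ∧ z 1 ≤ z 0 := fun z => by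
    rw [hRd]
    exact z2_mem_tri
  have hmemR' : ∀ z, z ∈ (R.reindex (Equiv.swap (0 : Fin 2) 1)).domain ↔
      (0 < z 1 ∧ z 1 < 1) ∧ 0 ≤ z 0 ∧ z 0 ≤ z 1 := fun z => by
    rw [IntegralRep.reindex_domain, mem_setOf_eq, hmemR]
    simp only [Equiv.swap_apply_left, Equiv.swap_apply_right]
  have hmemB : ∀ z, z ∈ Za.domain ↔ (0 < z 0 ∧ z 0 < 1) ∧ (0 < z 1 ∧ z 1 < 1) := fun z => by
    rw [hZad]
    exact Fin.forall_fin_two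
  -- the four hypotheses of the almost-partition lemma
  have hA : volume (R.domain \ Za.domain) = 0 := by
    refine measure_mono_null (fun z hz => ?_)
      (Measure.pi_hyperplane (fun _ => (volume : Measure ℝ)) 1 0)
    have h1 := (hmemR z).1 hz.1
    show z 1 = 0
    by_contra h0
    exact hz.2 ((hmemB z).2 ⟨h1.1, lt_of_le_of_ne h1.2.1 (Ne.symm h0), h1.2.2.trans_lt h1.1.2⟩)
  have hA' : volume ((R.reindex (Equiv.swap (0 : Fin 2) 1)).domain \ Za.domain) = 0 := by
    refine measure_mono_null (fun z hz => ?_)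
      (Measure.pi_hyperplane (fun _ => (volume : Measure ℝ)) 0 0)
    have h1 := (hmemR' z).1 hz.1
    show z 0 = 0
    by_contra h0
    exact hz.2 ((hmemB z).2 ⟨⟨lt_of_le_of_ne h1.2.1 (Ne.symm h0), h1.2.2.trans_lt h1.1.2⟩, h1.1⟩)
  have hE : EqOn R.integrand Za.integrand (R.domain ∩ Za.domain) := fun z _ => by
    rw [hRi, hZai]
  have hE' : EqOn (R.reindex (Equiv.swap (0 : Fin 2) 1)).integrand Za.integrand
      ((R.reindex (Equiv.swap (0 : Fin 2) 1)).domain ∩ Za.domain) := fun z _ => by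
    rw [IntegralRep.reindex_integrand, hRi, hZai]
    simp only [Equiv.swap_apply_left, Equiv.swap_apply_right]
    congr 1
    ring
  have hcov : Za.domain ⊆ ⋃ i ∈ (Finset.univ : Finset (Fin 2)),
      ((![R, R.reindex (Equiv.swap (0 : Fin 2) 1)] : Fin 2 → IntegralRep 2) i).domain := by
    intro z hz
    have hB := (hmemB z).1 hz
    simp only [Finset.mem_univ, iUnion_true, mem_iUnion]
    rcases le_total (z 1) (z 0) with hle | hle
    · exact ⟨0, (hmemR z).2 ⟨hB.1, hB.2.1.le, hle⟩⟩
    · exact ⟨1, (hmemR' z).2 ⟨hB.2, hB.1.1.le, hle⟩⟩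
  -- the diagonal is null (a graph over the first coordinate)
  have hdiag : volume {z : Fin 2 → ℝ | z 1 = z 0} = 0 := by
    have h := volume_graph_eq_zero (n := 1) (σ := univ) (u := fun y => y 0)
      (isSemialgebraicFunOn_apply isSemialgebraic_univ 0)
    refine measure_mono_null (fun z hz => ?_) h
    exact ⟨mem_univ _, hz⟩
  have h01 : volume (R.domain ∩ (R.reindex (Equiv.swap (0 : Fin 2) 1)).domain) = 0 :=
    measure_mono_null (fun z hz => le_antisymm ((hmemR z).1 hz.1).2.2 ((hmemR' z).1 hz.2).2.2)
      hdiag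
  have h := of_sub_sum_of_mem_relations (Finset.univ : Finset (Fin 2)) Za
    ![R, R.reindex (Equiv.swap (0 : Fin 2) 1)]
    (Fin.forall_fin_two.2 ⟨fun _ => hA, fun _ => hA'⟩)
    (Fin.forall_fin_two.2 ⟨fun _ => hE, fun _ => hE'⟩)
    (by rw [Set.sdiff_eq_empty.2 hcov, measure_empty]) ?_
  · simp only [Fin.sum_univ_two, Matrix.cons_val_zero, Matrix.cons_val_one] at h
    exact h
  · intro i _ j _ hij
    fin_cases i <;> fin_cases j
    · exact absurd rfl hij
    · exact h01
    · rw [inter_comm]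
      exact h01
    · exact absurd rfl hij

/-- **The corner blow-up** `x₁ = x₀ θ` (rule (2): the affine substitution along the last coordinate
over the open base `(0,1)`, `KZ.of_sub_of_mem_relations_of_affine` with `α = 0`, `β = x₀`,
Jacobian `x₀`): `[{0 < x₀ < 1, 0 ≤ θ ≤ 1}, 1/(1 + θ(1 − x₀))] − [T, 1/(x₀ + x₁ − x₀x₁)] ∈ relations`,
because `x₀/(x₀ + x₀θ − x₀²θ) = 1/(1 + θ(1 − x₀))`. [Kontsevich–Zagier 2001, §1.2 rule (2)] -/
theorem z2_blowup (r R : IntegralRep 2)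
    (hrd : r.domain = KZlog.band {y : Fin 1 → ℝ | 0 < y 0 ∧ y 0 < 1} (fun _ => (0:ℝ)) (fun _ => (1:ℝ)))
    (hri : r.integrand = fun x => 1 / (1 + x 1 * (1 - x 0)))
    (hRd : R.domain = KZlog.band {y : Fin 1 → ℝ | 0 < y 0 ∧ y 0 < 1} (fun _ => (0:ℝ)) (fun y => y 0))
    (hRi : R.integrand = fun x => 1 / (x 0 + x 1 - x 0 * x 1)) :
    of r - of R ∈ relations := by
  have hG : IsSemialgebraic ℚ {y : Fin 1 → ℝ | 0 < y 0 ∧ y 0 < 1} :=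
    isSemialgebraic_unitInterval_fin_one
  have hGo : IsOpen {y : Fin 1 → ℝ | 0 < y 0 ∧ y 0 < 1} :=
    isOpen_Ioo.preimage (continuous_apply 0)
  refine of_sub_of_mem_relations_of_affine (m := 1) hGo (α := fun _ => (0:ℝ)) (β := fun y => y 0)
    (a := fun _ => (0:ℝ)) (b := fun _ => (1:ℝ)) (a' := fun _ => (0:ℝ)) (b' := fun y => y 0)
    (by simpa using isSemialgebraicFunOn_ratCast hG 0) (isSemialgebraicFunOn_apply hG 0)
    (differentiableOn_const 0) (differentiableOn_apply 0 _) (fun y hy => hy.1) r R hrd hRd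
    (fun y _ => by ring) (fun y _ => by ring) fun z hz => ?_
  rw [hrd] at hz
  have h := z2_mem_boxBand.1 hz
  rw [hri, hRi]
  exact z2_blowup_identity (x := z 0) (t := z 1) h.1.1.ne'

/-- **The resolved integrand is a tame cube class.** `H(x) = 1/(1 + x₁(1 − x₀))` is analytic at every
point of `[0,1]²` (its denominator is `≥ 1` there) and `ℚ`-semialgebraic (a rational function), so
`[[0,1]², H] = [tameCube H] ∈ cubicalGens`; its restriction to the band `{0 < x₀ < 1}` differs from
it by the two null edges `x₀ ∈ {0, 1}` (rule (1)).
[Ayoub 2014, Def. 6; Kontsevich–Zagier 2001, §1.2 rule (1)] -/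
theorem z2_exists_tame :
    ∃ Tm r : IntegralRep 2, of Tm ∈ cubicalGens ∧
      r.domain = KZlog.band {y : Fin 1 → ℝ | 0 < y 0 ∧ y 0 < 1} (fun _ => (0:ℝ)) (fun _ => (1:ℝ)) ∧
      (r.integrand = fun x => 1 / (1 + x 1 * (1 - x 0))) ∧ of Tm - of r ∈ relations := by
  have hden : ∀ x ∈ KZ.cube 2, (0:ℝ) < 1 + x 1 * (1 - x 0) := fun x hx => by
    have h0 := hx 0
    have h1 := hx 1
    nlinarith [h0.1, h0.2, h1.1, h1.2]
  have hH : AnalyticOnNhd ℝ (fun x : Fin 2 → ℝ => 1 / (1 + x 1 * (1 - x 0))) (KZ.cube 2) := by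
    intro x hx
    have hp : ∀ i : Fin 2, AnalyticAt ℝ (fun y : Fin 2 → ℝ => y i) x := fun i =>
      (ContinuousLinearMap.proj (R := ℝ) (φ := fun _ : Fin 2 => ℝ) i).analyticAt x
    exact analyticAt_const.div (analyticAt_const.add ((hp 1).mul (analyticAt_const.sub (hp 0))))
      (hden x hx).ne'
  have hsa : IsSemialgebraicFunOn ℚ (KZ.cube 2) (fun x : Fin 2 → ℝ => 1 / (1 + x 1 * (1 - x 0))) := by
    refine (isSemialgebraicFunOn_aeval_div_aeval KZ.isSemialgebraic_cube 1
      (1 + MvPolynomial.X 1 * (1 - MvPolynomial.X 0)) fun x hx => ?_).congr fun x _ => by simp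
    simp only [map_add, map_mul, map_sub, map_one, MvPolynomial.aeval_X]
    exact (hden x hx).ne'
  have hG : IsSemialgebraic ℚ {y : Fin 1 → ℝ | 0 < y 0 ∧ y 0 < 1} :=
    isSemialgebraic_unitInterval_fin_one
  have hBand : IsSemialgebraic ℚ
      (KZlog.band {y : Fin 1 → ℝ | 0 < y 0 ∧ y 0 < 1} (fun _ => (0:ℝ)) (fun _ => (1:ℝ))) :=
    KZlog.isSemialgebraic_band (by simpa using isSemialgebraicFunOn_ratCast hG 0)
      (by simpa using isSemialgebraicFunOn_ratCast hG 1)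
  have hsub : KZlog.band {y : Fin 1 → ℝ | 0 < y 0 ∧ y 0 < 1} (fun _ => (0:ℝ)) (fun _ => (1:ℝ)) ⊆
      (IntegralRep.tameCube _ hH hsa).domain := by
    intro z hz
    have h := z2_mem_boxBand.1 hz
    rw [IntegralRep.tameCube_domain]
    exact Fin.forall_fin_two.2 ⟨⟨h.1.1.le, h.1.2.le⟩, h.2⟩
  have hnull : volume ((IntegralRep.tameCube _ hH hsa).domain \
      KZlog.band {y : Fin 1 → ℝ | 0 < y 0 ∧ y 0 < 1} (fun _ => (0:ℝ)) (fun _ => (1:ℝ))) = 0 := by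
    refine measure_mono_null (fun z hz => ?_)
      (measure_union_null (Measure.pi_hyperplane (fun _ => (volume : Measure ℝ)) 0 0)
        (Measure.pi_hyperplane (fun _ => (volume : Measure ℝ)) 0 1))
    rw [IntegralRep.tameCube_domain] at hz
    have h0 := hz.1 0
    have h1 := hz.1 1
    by_contra hne
    simp only [mem_union, mem_setOf_eq, not_or] at hne
    exact hz.2 (z2_mem_boxBand.2
      ⟨⟨lt_of_le_of_ne h0.1 (Ne.symm hne.1), lt_of_le_of_ne h0.2 hne.2⟩, h1⟩)
  exact ⟨IntegralRep.tameCube _ hH hsa, (IntegralRep.tameCube _ hH hsa).restrict _ hBand hsub,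
    ⟨2, IntegralRep.tameCube _ hH hsa, rfl, hH, rfl⟩, rfl, rfl,
    (IntegralRep.tameCube _ hH hsa).of_sub_of_restrict_mem_relations hBand hsub hnull⟩

/-- **Z1: Beukers' box representation of `ζ(2)` is resolved** (registered stub
`stub_zetaTwoBoxResolved` of crux stmt-KontsevichZagierPeriods-10813, line
`effective-cube-surjection`). For every representation `Z = [(0,1)², f]` with `f = 1/(1 − x₀x₁)` on
the box there is `a ∈ cubicalSpan` (namely twice the tame cube class
`[[0,1]², 1/(1 + x₁(1 − x₀))]`) with `[Z] − a ∈ relations`: reflect (`z2_exists_reflected`), cut along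
the diagonal (`z2_split`, the mirror triangle being the reindexed one,
`KZ.of_sub_of_reindex_mem_relations`), blow up the corner on the triangle (`z2_blowup`) and close the
two null edges (`z2_exists_tame`).
[Beukers 1979; Kontsevich–Zagier 2001, §1.2 rules (1), (2); Ayoub 2014, Def. 6] -/
theorem stub_zetaTwoBoxResolved :
    ∀ (Z : IntegralRep 2), Z.domain = {x : Fin 2 → ℝ | ∀ i, x i ∈ Set.Ioo (0:ℝ) 1} → (∀ x ∈ Z.domain, Z.integrand x = 1 / (1 - x 0 * x 1)) → ∃ a : FormalRep, a ∈ cubicalSpan ∧ of Z - a ∈ relations := by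
  intro Z hZd hZi
  obtain ⟨Za, hZad, hZai, e1⟩ := z2_exists_reflected Z hZd hZi
  obtain ⟨R, hRd, hRi⟩ := z2_exists_triRep Za hZad hZai
  have e2 := z2_split Za R hZad hZai hRd hRi
  have e3 := of_sub_of_reindex_mem_relations R (Equiv.swap (0 : Fin 2) 1)
  obtain ⟨Tm, r, hTm, hrd, hri, e4⟩ := z2_exists_tame
  have e5 := z2_blowup r R hrd hri hRd hRi
  refine ⟨of Tm + of Tm, cubicalSpan.add_mem (AddSubgroup.subset_closure hTm)
    (AddSubgroup.subset_closure hTm), ?_⟩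
  have : of Z - (of Tm + of Tm) = (of Za - (of R + of (R.reindex (Equiv.swap (0 : Fin 2) 1))))
      - (of R - of (R.reindex (Equiv.swap (0 : Fin 2) 1)))
      - (of Tm - of r) - (of Tm - of r) - (of r - of R) - (of r - of R) - (of Za - of Z) := by
    abel
  rw [this]
  exact relations.sub_mem (relations.sub_mem (relations.sub_mem (relations.sub_mem
    (relations.sub_mem (relations.sub_mem e2 e3) e4) e4) e5) e5) e1

end Summit.KontsevichZagierPeriods.FurushoPentagon.SectorToKernel
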